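import Mathlib
import Summits.ResolutionOfSingularities.ResolutionOfSingularities.Theorems.WeightedInvariantLocalWeightedDropNCProductClosure
import Summits.ResolutionOfSingularities.ResolutionOfSingularities.Theorems.WeightedInvariantLocalWeightedDropNCGamePlane

/-!
# `LocalWeightedDrop`, line `nc-game-transport`, TOT rung R5 — CONSEQUENCES: products of germs in disjoint variables that are FINITELY
# WINNABLE IN THE NC COUNT GAME, and the weighted-game wins they transport to

[OURS · L1 W4.3 · chain w43, engine crux `LocalWeightedDrop` stmt-ResolutionOfSingularities-8899; strategist res-L1-w43-strat-1, line
`nc-game-transport` (transport `NCTransport.won_of_winsIn` p507842, residual ladder `HTOT m` …NCGameTotality, rungs R0 …NCSmoothPower /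
R5 …NCProductClosure (res-D-pv-006) / `HTOT 1` = `winsIn_plane` …NCGamePlane (res-type-088)); res-L1-w43-plan-1 RULING gen 9 #5 (3).
Objects = the programme's own games; NOT a statement of any manuscript; closes nothing by name.  What R5 buys (STRATEGY-CENSUS v1.2 (D-b)):
sorry-free `HTOT`-INSTANCES in every dimension — the decomposable germs.]

* `mul_disjoint_ne_zero` — `embL b₁ · embR b₂ ≠ 0` for `b₁, b₂ ≠ 0`.
* `won_of_dvd_mul_disjoint_pow` — R5 THROUGH THE TRANSPORT: in characteristic `p`, if `b₁ ≠ 0` (in `m₁ + 1` variables) and `b₂ ≠ 0` (in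
  `m₂ + 1` variables) are finitely winnable, EVERY DIVISOR OF A POWER of `embL b₁ · embR b₂` is in the winning region
  `CobordantGame.Won k (m₁ + m₂ + 2)` of the local weighted resolution game.
* **FACT-FREE, EVERY FIELD**: `exists_winsIn_planeProduct` — a product `b₁(x₀,x₁) · b₂(x₂,x₃)` of two non-zero PLANE CURVE GERMS in disjoint
  variables is won in the NC count game on `k⟦x₀,…,x₃⟧` in finitely many rounds (`winsIn_plane` × `winsIn_plane` through R5); hence
  (`won_of_dvd_planeProduct_pow`, prime characteristic) every divisor of a power of such a product — e.g. `(x₀² + x₁³)·(x₂² + x₃⁵)`, any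
  product of plane curve singularities in two disjoint pairs of variables, and all their factors — is `CobordantGame.Won k 4`: a class of
  FOUR-VARIABLE germs (the regime of the residual W4|₄) outside every earlier tree theorem on `Won k 4`, now won with no hypothesis.
* `germIsNC_one`, `winsIn_germIsNC_cylinder` (R5 with second factor `1`: CYLINDERS keep the round count), `won_of_dvd_cylinder_pow`,
  `won_of_dvd_planeCylinder_pow` (fact-free: cylinders over plane curve germs in any number of variables).
* `winsIn_germIsNC_mul_split`, `won_of_dvd_mul_split_pow` — the same for ANY splitting `Fin (m₁+1) ⊕ Fin (m₂+1) ≃ Fin (M+1)` of the variables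
  into two complementary sets (R5 conjugated by a permutation of the variables, `isUnit_det_linMat_perm` + `winsIn_germIsNC_subst`).
* `exists_winsIn_mul_disjoint_of_htot` — `HTOT m₁`, `HTOT m₂` ⇒ products in disjoint blocks are finitely winnable in `m₁ + m₂ + 2` variables
  (algebraically closed `k` of characteristic `p`); with ⟨F-32bR⟩ (`htot_two_of_CJSB`) and `htot_one`: `exists_winsIn_planeSurfaceProduct_of_CJSB`
  (5 variables), `exists_winsIn_surfaceProduct_of_CJSB` (6 variables).
-/

noncomputable section

open Literature.AlgebraicGeometry.Resolution

set_option linter.dupNamespace false -- mandated namespace of this single-conjunct summit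

namespace Summit.ResolutionOfSingularities.ResolutionOfSingularities.Theorems

namespace NCTransport

open MvPowerSeries TameFourTupleDrop

variable {k : Type} [Field k]

/-- `embL b₁ · embR b₂ ≠ 0` for non-zero `b₁`, `b₂` (census spelling of the block embeddings). -/
theorem mul_disjoint_ne_zero (m₁ m₂ : ℕ) {b₁ : MvPowerSeries (Fin (m₁ + 1)) k} {b₂ : MvPowerSeries (Fin (m₂ + 1)) k}
    (hb₁ : b₁ ≠ 0) (hb₂ : b₂ ≠ 0) :
    MvPowerSeries.subst (fun i : Fin (m₁ + 1) => (X ⟨i.val, by omega⟩ : MvPowerSeries (Fin (m₁ + m₂ + 1 + 1)) k)) b₁ *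
        MvPowerSeries.subst (fun j : Fin (m₂ + 1) => (X ⟨m₁ + 1 + j.val, by omega⟩ : MvPowerSeries (Fin (m₁ + m₂ + 1 + 1)) k)) b₂ ≠ 0 := by
  have h := mul_ne_zero (rename_ne_zero (bL (rfl : m₁ + m₂ + 1 = m₁ + m₂ + 1)) hb₁) (rename_ne_zero (bR (rfl : m₁ + m₂ + 1 = m₁ + m₂ + 1)) hb₂)
  rw [rename_eq_subst, rename_eq_subst] at h
  exact h

/-- **R5 THROUGH THE TRANSPORT** (OURS · L1 W4.3): in characteristic `p`, if `b₁ ≠ 0` and `b₂ ≠ 0` are finitely winnable in the NC count game,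
every divisor of a power of `embL b₁ · embR b₂` is in the winning region of the weighted game in `m₁ + m₂ + 2` variables. -/
theorem won_of_dvd_mul_disjoint_pow (p : ℕ) (hp : p.Prime) [CharP k p] (m₁ m₂ : ℕ) {b₁ : MvPowerSeries (Fin (m₁ + 1)) k}
    {b₂ : MvPowerSeries (Fin (m₂ + 1)) k} (hb₁ : b₁ ≠ 0) (hb₂ : b₂ ≠ 0) (h₁ : ∃ n, WinsIn (m := m₁) GermIsNC n b₁)
    (h₂ : ∃ n, WinsIn (m := m₂) GermIsNC n b₂) (N : ℕ) (f : MvPowerSeries (Fin (m₁ + m₂ + 1 + 1)) k)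
    (hf : f ∣ (MvPowerSeries.subst (fun i : Fin (m₁ + 1) => (X ⟨i.val, by omega⟩ : MvPowerSeries (Fin (m₁ + m₂ + 1 + 1)) k)) b₁ *
        MvPowerSeries.subst (fun j : Fin (m₂ + 1) => (X ⟨m₁ + 1 + j.val, by omega⟩ : MvPowerSeries (Fin (m₁ + m₂ + 1 + 1)) k)) b₂) ^ (N + 1)) :
    CobordantGame.Won k (m₁ + m₂ + 1 + 1) f := by
  obtain ⟨n, hn⟩ := exists_winsIn_germIsNC_mul_disjoint m₁ m₂ hb₁ hb₂ h₁ h₂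
  exact won_of_winsIn p hp n _ (mul_disjoint_ne_zero m₁ m₂ hb₁ hb₂) hn N f hf

/-! ## Cylinders -/

/-- The constant germ `1` has normal-crossing support. -/
theorem germIsNC_one {n : ℕ} : GermIsNC (1 : MvPowerSeries (Fin n) k) :=
  ⟨X, 1, 0, fun i => constantCoeff_X i, isUnit_det_linMat_perm (Equiv.refl _), by simp, by simp [subst_self]⟩

/-- **CYLINDERS** (OURS · L1 W4.3; R5 with the second factor `1`): a finitely winnable germ `b ≠ 0` in `m₁ + 1` variables, read in
`m₂ + 1` further variables, is finitely winnable in the SAME number of rounds. -/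
theorem winsIn_germIsNC_cylinder (m₁ m₂ : ℕ) {b : MvPowerSeries (Fin (m₁ + 1)) k} (hb : b ≠ 0) {n : ℕ}
    (h : WinsIn (m := m₁) GermIsNC n b) :
    WinsIn (m := m₁ + m₂ + 1) GermIsNC n
      (MvPowerSeries.subst (fun i : Fin (m₁ + 1) => (X ⟨i.val, by omega⟩ : MvPowerSeries (Fin (m₁ + m₂ + 1 + 1)) k)) b) := by
  have h1 := winsIn_germIsNC_mul_disjoint m₁ m₂ b 1 n 0 hb one_ne_zero h ((winsIn_zero _ _).mpr germIsNC_one)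
  have hs : HasSubst (fun j : Fin (m₂ + 1) => (X ⟨m₁ + 1 + j.val, by omega⟩ : MvPowerSeries (Fin (m₁ + m₂ + 1 + 1)) k)) :=
    hasSubst_of_constantCoeff_zero fun j => constantCoeff_X _
  rwa [← coe_substAlgHom hs, map_one, mul_one, Nat.add_zero n] at h1

/-- Cylinders through the transport: in characteristic `p`, every divisor of a power of a cylinder over a finitely winnable germ is in the
winning region of the weighted game (in `m₁ + m₂ + 2` variables). -/
theorem won_of_dvd_cylinder_pow (p : ℕ) (hp : p.Prime) [CharP k p] (m₁ m₂ : ℕ) {b : MvPowerSeries (Fin (m₁ + 1)) k} (hb : b ≠ 0)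
    (h : ∃ n, WinsIn (m := m₁) GermIsNC n b) (N : ℕ) (f : MvPowerSeries (Fin (m₁ + m₂ + 1 + 1)) k)
    (hf : f ∣ (MvPowerSeries.subst (fun i : Fin (m₁ + 1) => (X ⟨i.val, by omega⟩ : MvPowerSeries (Fin (m₁ + m₂ + 1 + 1)) k)) b) ^ (N + 1)) :
    CobordantGame.Won k (m₁ + m₂ + 1 + 1) f := by
  obtain ⟨n, hn⟩ := h
  have hne : MvPowerSeries.subst (fun i : Fin (m₁ + 1) => (X ⟨i.val, by omega⟩ : MvPowerSeries (Fin (m₁ + m₂ + 1 + 1)) k)) b ≠ 0 := by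
    have h' := rename_ne_zero (bL (rfl : m₁ + m₂ + 1 = m₁ + m₂ + 1)) hb
    rwa [rename_eq_subst] at h'
  exact won_of_winsIn p hp n _ hne (winsIn_germIsNC_cylinder m₁ m₂ hb hn) N f hf

/-- FACT-FREE: every divisor of a power of a CYLINDER OVER A PLANE CURVE GERM (`b(x₀,x₁)` read in `m₂ + 3` variables), in characteristic
`p`, is in the winning region of the weighted game. -/
theorem won_of_dvd_planeCylinder_pow (p : ℕ) (hp : p.Prime) [CharP k p] (m₂ : ℕ) (b : MvPowerSeries (Fin 2) k) (hb : b ≠ 0)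
    (N : ℕ) (f : MvPowerSeries (Fin (1 + m₂ + 1 + 1)) k)
    (hf : f ∣ (MvPowerSeries.subst (fun i : Fin 2 => (X ⟨i.val, by omega⟩ : MvPowerSeries (Fin (1 + m₂ + 1 + 1)) k)) b) ^ (N + 1)) :
    CobordantGame.Won k (1 + m₂ + 1 + 1) f :=
  won_of_dvd_cylinder_pow p hp 1 m₂ hb (winsIn_plane k b hb) N f hf

/-! ## Fact-free: products of plane curve germs -/

/-- **PRODUCTS OF TWO PLANE CURVE GERMS IN DISJOINT VARIABLES ARE FINITELY WINNABLE** (OURS · L1 W4.3; every field, no hypothesis): for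
non-zero `b₁, b₂ ∈ k⟦y₀,y₁⟧`, the germ `b₁(x₀,x₁) · b₂(x₂,x₃) ∈ k⟦x₀,…,x₃⟧` is won in the NC count game in finitely many rounds. -/
theorem exists_winsIn_planeProduct (b₁ b₂ : MvPowerSeries (Fin 2) k) (hb₁ : b₁ ≠ 0) (hb₂ : b₂ ≠ 0) :
    ∃ n, WinsIn (m := 3) GermIsNC n
      (MvPowerSeries.subst (fun i : Fin 2 => (X ⟨i.val, by omega⟩ : MvPowerSeries (Fin 4) k)) b₁ *
        MvPowerSeries.subst (fun j : Fin 2 => (X ⟨2 + j.val, by omega⟩ : MvPowerSeries (Fin 4) k)) b₂) :=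
  exists_winsIn_germIsNC_mul_disjoint 1 1 hb₁ hb₂ (winsIn_plane k b₁ hb₁) (winsIn_plane k b₂ hb₂)

/-- **FACT-FREE FOUR-VARIABLE WINS OF THE WEIGHTED GAME** (OURS · L1 W4.3): in prime characteristic, every divisor `f` of a power of a product
`b₁(x₀,x₁) · b₂(x₂,x₃)` of two non-zero plane curve germs in disjoint variables is in the winning region `CobordantGame.Won k 4` of the local
weighted resolution game. -/
theorem won_of_dvd_planeProduct_pow (p : ℕ) (hp : p.Prime) [CharP k p] (b₁ b₂ : MvPowerSeries (Fin 2) k) (hb₁ : b₁ ≠ 0) (hb₂ : b₂ ≠ 0)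
    (N : ℕ) (f : MvPowerSeries (Fin 4) k)
    (hf : f ∣ (MvPowerSeries.subst (fun i : Fin 2 => (X ⟨i.val, by omega⟩ : MvPowerSeries (Fin 4) k)) b₁ *
        MvPowerSeries.subst (fun j : Fin 2 => (X ⟨2 + j.val, by omega⟩ : MvPowerSeries (Fin 4) k)) b₂) ^ (N + 1)) :
    CobordantGame.Won k 4 f :=
  won_of_dvd_mul_disjoint_pow p hp 1 1 hb₁ hb₂ (winsIn_plane k b₁ hb₁) (winsIn_plane k b₂ hb₂) N f hf

/-- In particular the product itself is won (not only its divisors). -/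
theorem won_planeProduct (p : ℕ) (hp : p.Prime) [CharP k p] (b₁ b₂ : MvPowerSeries (Fin 2) k) (hb₁ : b₁ ≠ 0) (hb₂ : b₂ ≠ 0) :
    CobordantGame.Won k 4
      (MvPowerSeries.subst (fun i : Fin 2 => (X ⟨i.val, by omega⟩ : MvPowerSeries (Fin 4) k)) b₁ *
        MvPowerSeries.subst (fun j : Fin 2 => (X ⟨2 + j.val, by omega⟩ : MvPowerSeries (Fin 4) k)) b₂) :=
  won_of_dvd_planeProduct_pow p hp b₁ b₂ hb₁ hb₂ 0 _ (by rw [zero_add, pow_one])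

/-! ## Arbitrary complementary blocks -/

/-- **ANY SPLITTING OF THE VARIABLES** (OURS · L1 W4.3; R5 conjugated by a permutation): for every decomposition
`e : Fin (m₁+1) ⊕ Fin (m₂+1) ≃ Fin (M+1)` of the variables into two complementary sets, if `b₁ ≠ 0` is won within `n₁` rounds and `b₂ ≠ 0`
within `n₂` rounds, then `b₁(x_{e(inl ·)}) · b₂(x_{e(inr ·)})` is won within `n₁ + n₂` rounds (`winsIn_germIsNC_mul_blocks` transported along
the permutation `blockEquiv⁻¹ ≫ e` by `winsIn_germIsNC_subst`). -/
theorem winsIn_germIsNC_mul_split {m₁ m₂ M : ℕ} (e : Fin (m₁ + 1) ⊕ Fin (m₂ + 1) ≃ Fin (M + 1)) {b₁ : MvPowerSeries (Fin (m₁ + 1)) k}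
    {b₂ : MvPowerSeries (Fin (m₂ + 1)) k} (hb₁ : b₁ ≠ 0) (hb₂ : b₂ ≠ 0) {n₁ n₂ : ℕ} (h₁ : WinsIn (m := m₁) GermIsNC n₁ b₁)
    (h₂ : WinsIn (m := m₂) GermIsNC n₂ b₂) :
    WinsIn (m := M) GermIsNC (n₁ + n₂) (rename (fun i => e (Sum.inl i)) b₁ * rename (fun j => e (Sum.inr j)) b₂) := by
  have hM : m₁ + m₂ + 1 = M := by
    have hc := Fintype.card_congr e
    simp only [Fintype.card_sum, Fintype.card_fin] at hc
    omega
  set π : Equiv.Perm (Fin (M + 1)) := (blockEquiv hM).symm.trans e with hπ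
  have hπL : (⇑π ∘ ⇑(bL hM)) = fun i => e (Sum.inl i) := funext fun i => by simp [hπ]
  have hπR : (⇑π ∘ ⇑(bR hM)) = fun j => e (Sum.inr j) := funext fun j => by simp [hπ]
  have hs : HasSubst (X ∘ ⇑π : Fin (M + 1) → MvPowerSeries (Fin (M + 1)) k) := HasSubst.X_comp _
  have ht := winsIn_germIsNC_subst (Ψ := X ∘ ⇑π) (fun l => constantCoeff_X _) (isUnit_det_linMat_perm π) _ _
    (winsIn_germIsNC_mul_blocks hM hb₁ hb₂ h₁ h₂)
  rwa [← coe_substAlgHom hs, map_mul, coe_substAlgHom, subst_rename_eq _ hs, subst_rename_eq _ hs, Function.comp_assoc,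
    Function.comp_assoc, hπL, hπR, ← rename_eq_subst, ← rename_eq_subst] at ht

/-- Through the transport, for any splitting of the variables: in characteristic `p`, every divisor of a power of
`b₁(x_{e(inl ·)}) · b₂(x_{e(inr ·)})` with `b₁`, `b₂` finitely winnable is in the winning region of the weighted game. -/
theorem won_of_dvd_mul_split_pow (p : ℕ) (hp : p.Prime) [CharP k p] {m₁ m₂ M : ℕ} (e : Fin (m₁ + 1) ⊕ Fin (m₂ + 1) ≃ Fin (M + 1))
    {b₁ : MvPowerSeries (Fin (m₁ + 1)) k} {b₂ : MvPowerSeries (Fin (m₂ + 1)) k} (hb₁ : b₁ ≠ 0) (hb₂ : b₂ ≠ 0)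
    (h₁ : ∃ n, WinsIn (m := m₁) GermIsNC n b₁) (h₂ : ∃ n, WinsIn (m := m₂) GermIsNC n b₂) (N : ℕ) (f : MvPowerSeries (Fin (M + 1)) k)
    (hf : f ∣ (rename (fun i => e (Sum.inl i)) b₁ * rename (fun j => e (Sum.inr j)) b₂) ^ (N + 1)) :
    CobordantGame.Won k (M + 1) f := by
  obtain ⟨n₁, hn₁⟩ := h₁
  obtain ⟨n₂, hn₂⟩ := h₂
  have hne : rename (fun i => e (Sum.inl i)) b₁ * rename (fun j => e (Sum.inr j)) b₂ ≠ 0 :=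
    mul_ne_zero (rename_ne_zero ⟨fun i => e (Sum.inl i), fun i j h => Sum.inl_injective (e.injective h)⟩ hb₁)
      (rename_ne_zero ⟨fun j => e (Sum.inr j), fun i j h => Sum.inr_injective (e.injective h)⟩ hb₂)
  exact won_of_winsIn p hp _ _ hne (winsIn_germIsNC_mul_split e hb₁ hb₂ hn₁ hn₂) N f hf

/-! ## Along the residual ladder `HTOT` -/

/-- `HTOT m₁`, `HTOT m₂` ⇒ products in disjoint blocks are finitely winnable in `m₁ + m₂ + 2` variables (algebraically closed fields of
characteristic `p`). -/
theorem exists_winsIn_mul_disjoint_of_htot {m₁ m₂ : ℕ} (h₁ : HTOT m₁) (h₂ : HTOT m₂) (p : ℕ) (hp : p.Prime) [CharP k p] [IsAlgClosed k]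
    {b₁ : MvPowerSeries (Fin (m₁ + 1)) k} {b₂ : MvPowerSeries (Fin (m₂ + 1)) k} (hb₁ : b₁ ≠ 0) (hb₂ : b₂ ≠ 0) :
    ∃ n, WinsIn (m := m₁ + m₂ + 1) GermIsNC n
      (MvPowerSeries.subst (fun i : Fin (m₁ + 1) => (X ⟨i.val, by omega⟩ : MvPowerSeries (Fin (m₁ + m₂ + 1 + 1)) k)) b₁ *
        MvPowerSeries.subst (fun j : Fin (m₂ + 1) => (X ⟨m₁ + 1 + j.val, by omega⟩ : MvPowerSeries (Fin (m₁ + m₂ + 1 + 1)) k)) b₂) :=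
  exists_winsIn_germIsNC_mul_disjoint m₁ m₂ hb₁ hb₂ (h₁ p hp k b₁ hb₁) (h₂ p hp k b₂ hb₂)

/-- Modulo ⟨F-32bR⟩: a plane curve germ times a surface germ in disjoint variables (5 variables) is finitely winnable. -/
theorem exists_winsIn_planeSurfaceProduct_of_CJSB (hCJS : CossartJannsenSaito2020EmbeddedSequenceB.{0}) (p : ℕ) (hp : p.Prime)
    [CharP k p] [IsAlgClosed k] {b₁ : MvPowerSeries (Fin 2) k} {b₂ : MvPowerSeries (Fin 3) k} (hb₁ : b₁ ≠ 0) (hb₂ : b₂ ≠ 0) :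
    ∃ n, WinsIn (m := 4) GermIsNC n
      (MvPowerSeries.subst (fun i : Fin 2 => (X ⟨i.val, by omega⟩ : MvPowerSeries (Fin 5) k)) b₁ *
        MvPowerSeries.subst (fun j : Fin 3 => (X ⟨2 + j.val, by omega⟩ : MvPowerSeries (Fin 5) k)) b₂) :=
  exists_winsIn_mul_disjoint_of_htot htot_one (htot_two_of_CJSB hCJS) p hp hb₁ hb₂

/-- Modulo ⟨F-32bR⟩: a product of two surface germs in disjoint variables (6 variables) is finitely winnable. -/
theorem exists_winsIn_surfaceProduct_of_CJSB (hCJS : CossartJannsenSaito2020EmbeddedSequenceB.{0}) (p : ℕ) (hp : p.Prime)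
    [CharP k p] [IsAlgClosed k] {b₁ b₂ : MvPowerSeries (Fin 3) k} (hb₁ : b₁ ≠ 0) (hb₂ : b₂ ≠ 0) :
    ∃ n, WinsIn (m := 5) GermIsNC n
      (MvPowerSeries.subst (fun i : Fin 3 => (X ⟨i.val, by omega⟩ : MvPowerSeries (Fin 6) k)) b₁ *
        MvPowerSeries.subst (fun j : Fin 3 => (X ⟨3 + j.val, by omega⟩ : MvPowerSeries (Fin 6) k)) b₂) :=
  exists_winsIn_mul_disjoint_of_htot (htot_two_of_CJSB hCJS) (htot_two_of_CJSB hCJS) p hp hb₁ hb₂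

end NCTransport

end Summit.ResolutionOfSingularities.ResolutionOfSingularities.Theorems
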